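import Summits.BirchSwinnertonDyer.BirchSwinnertonDyer.Theorems.KimAtThreeFineKatoKPortReduction
import Summits.BirchSwinnertonDyer.BirchSwinnertonDyer.Theorems.KimAtThreeFineKatoKPortSatLogMap
import Literature.NumberTheory.EllipticCurves.PadicLogFiniteExtension
import HarnessLib

/-!
# K-PORT junction (J4a): the log-currency junction — kport's series logarithm `Λ = BallEval.ptLog` /
# saturated `Λ̃ = KPort.satLog` IS the Literature limit logarithm `FormalGroupChart.limitLog` /
# `padicLogPointFiniteExt ‖·‖ (curveK p K M) p` over any complete ultrametric `ℚ_p`-field `K`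
# (cell `bsd-addord`, seat w2-kport gen 3; `--supports stmt-BirchSwinnertonDyer-19560`, helper)

HONEST FRAMING. Route W2 (`route-BirchSwinnertonDyer-KimAtThreeKolyvagin`), crux 19560
`KatoKuriharaPortThreeShared`, registered line `perFactorKato` (stub hKloc, kim3 LEAD), clause (e) of the
displayed hypothesis hLog/hLog₀ ("`∀ z, ∀ ℓ ∈ Λ₀ʷ, ‖e₃⁻¹ Tr_{L_w/ℚ_v}(exp*_ω z · ℓ)‖ ≤ 1`", owner w2-acc4).
Two logarithm currencies meet there: kport's log-lattice `Λ₀ʷ = {Λ̃ P : P ∈ E₀(K_w)}` of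
`KPort.clause_d_unit_package` is built from the SERIES logarithm `BallEval.ptLog = log_E ∘ z` of the x1b
local series (saturated: `KPort.satLog`, file `…KPortSatLog`), while the Galois-side cite facts (S5b)
`PAdicHodge.exists_smul_range_expStarCoord_iff_trace_log` / the proposed (S5b-res) and w2-acc4's
DUALINT_w speak the Literature LIMIT logarithm `FormalGroupChart.padicLogPointFiniteExt w (W.baseChange F) p`
(`= limitLog(m•P)/m`, file `PadicLogFiniteExtension`). THIS FILE proves they are the SAME FUNCTION on
points, over the generic K-port currency (`K` any complete ultrametric normed `ℚ_p`-algebra field,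
`M/ℤ_p` any model, `E = curveK p K M`), with NO unramifiedness and NO reduction hypothesis:

* §1 `norm_natCast_prime`, `valuation_natCast_prime_lt_one`, `natCast_succ_le_prime_pow` (`n + 1 ≤ pⁿ`), **`norm_ptLog_sub_zCoord_le`** — the
  quadratic estimate `‖Λ(Q) − z(Q)‖ ≤ ‖z(Q)‖²/‖p‖` on the level `E⁽ᵖ⁾ = {Q ∈ E₁ : ‖z Q‖ ≤ ‖p‖}` (tangency
  of the series `log`, `BallEval.norm_bLog_sub_le` with `ρ = ‖p‖`, `B = ‖p‖⁻¹`).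
* §2 **`ptLog_spec`** — `Λ` has the approximation property (SPEC) of the `LimitLog` files on `E⁽ᵖ⁾`
  (w2-acc4's characterisation `spec_of_additive_of_val_sub_zCoord_le`: additive + quadratic estimate);
  **`ptLog_eq_limitLog`** — `Λ = limitLog ‖·‖ E p` on `E⁽ᵖ⁾` (`eq_limitLog_of_spec`);
  `ptLog_eq_limitLog_of_unramified` — on all of `E₁(K)` when `‖x‖ < 1 ⇒ ‖x‖ ≤ ‖p‖` (`E⁽ᵖ⁾ = E₁`).
* §3 **`satLog_eq_padicLogPointFiniteExt`** — `Λ̃ P = padicLogPointFiniteExt ‖·‖ E p P` for EVERY point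
  `P ∈ E(K)` (on `Ẽ₁(K)` both are `limitLog(m•P)/m` for a common admissible `m`, by
  `exists_pow_smul_mem_level_of_mem_kernel`; off `Ẽ₁(K)` both are the junk value `0`);
  `satLogHom_eq`, `satLog_eq_limitLog_nsmul_div` (`Λ̃ P = limitLog(m•P)/m` for any admissible `m`).
* §4 re-keying of the K-port's E-side statements into the Literature currency: at additive reduction
  `padicLogPointFiniteExt P = limitLog (p•P)/p` on `E₀(K)` (w2-acc4's `AdditiveProofs` shape,
  `padicLogPointFiniteExt_eq_limitLog_prime_nsmul_div_of_mem_E₀`); for `W/ℚ` globally minimal with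
  `Addv W p` over an UNRAMIFIED `K`: **`norm_padicLogPointFiniteExt_le_one_of_mem_E₀_of_addv`**
  (`‖log_ω Q‖ ≤ 1` on `E₀(K)`); on `ℚ_p`-points **`padicLogPointFiniteExt_map_ofId`**
  (`log_ω(ι P₀) = ι (padicLog X P₀)`, n1011's logarithm); Galois equivariance
  `padicLogPointFiniteExt_galois` in the K-port's `K ≃ₐ[ℚ_[p]] K` currency.

So every theorem of the K-port files (`…KPortSatLog`, `…SatLogMap`, `…Unramified`, `…Reduction`,
`…NormTrace`, `…LogLatticeUnit`, `…JunctionUnit`) is now a theorem about the Literature logarithm, and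
conversely the `LimitLog`/`PadicLogFiniteExtension` API (base change `padicLogPointFiniteExt_map_of_val_eq`,
`…_eq_zero_iff`, variable change) applies to `Λ̃`. TOOL theorems only (no definition, no named fact, no
`sorry`, no instance); closes nothing by itself; nothing booked; BSD / 19560 are not proved by any of this.
The `K := K_w` instantiation with the model identification `curveK 3 (Kw 3 L w) M_W = W.baseChange L_w`
is the sibling file `…KPortJunctionLog` (J4c).

References: J. H. Silverman, *The Arithmetic of Elliptic Curves*, 2nd ed. (2009), IV.5–IV.6 (Thm. IV.6.4,
Lemma IV.6.3), VII.2.1–2.2 [SilvermanAEC2009]; B. Mazur, J. Tate, J. Teitelbaum, Invent. Math. 84 (1986) §II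
(`log(P) = log([m]P)/m`) [MazurTateTeitelbaum1986]; C.-H. Kim, AJM 148 (2026) §3.2.3 [Kim2022StructureSelmer].
-/

noncomputable section

-- the cell's Theorems namespace `Summit.BirchSwinnertonDyer.BirchSwinnertonDyer.…` repeats the summit name by design (D-0017)
set_option linter.dupNamespace false

open scoped Classical NNReal

namespace Summit.BirchSwinnertonDyer.BirchSwinnertonDyer.Theorems.KPort

open Summit.BirchSwinnertonDyer.Rank1Residual.Additive Summit.BirchSwinnertonDyer.Rank1Residual.Additive.BallEval
open Summit.BirchSwinnertonDyer.Rank1Residual.Additive.LocalLog Literature.NumberTheory.EllipticCurves.Rank1Residual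
open Literature.NumberTheory.GaloisRepresentations.LubinTate (unitBall mem_unitBall_iff)
open Literature.NumberTheory.EllipticCurves Literature.NumberTheory.EllipticCurves.FormalGroupChart
open WeierstrassCurve

variable {p : ℕ} [hp : Fact p.Prime] {K : Type*} [NontriviallyNormedField K] [NormedAlgebra ℚ_[p] K]
  [IsUltrametricDist K] [CompleteSpace K] {M : WeierstrassCurve ℤ_[p]}
  [hE : (M.map PadicInt.Coe.ringHom).IsElliptic]
  [hint : (curveK p K M).IsIntegral (NormedField.valuation (K := K)).integer]

/-! ## §1 Constants and the quadratic estimate for the series logarithm on the level `E⁽ᵖ⁾` -/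

omit [IsUltrametricDist K] [CompleteSpace K] hE hint in
/-- `‖p‖ = p⁻¹` in a normed `ℚ_p`-algebra field. [folklore] -/
theorem norm_natCast_prime : ‖((p : ℕ) : K)‖ = (p : ℝ)⁻¹ := by
  have h : ((p : ℕ) : K) = algebraMap ℚ_[p] K (p : ℚ_[p]) := by rw [map_natCast]
  rw [h, norm_algebraMap_padic, Padic.norm_p]

omit [CompleteSpace K] hE hint in
/-- `‖p‖ < 1` in the `ℝ≥0`-valued norm valuation. [folklore] -/
theorem valuation_natCast_prime_lt_one : NormedField.valuation ((p : ℕ) : K) < 1 := by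
  rw [NormedField.valuation_apply, ← NNReal.coe_lt_coe, coe_nnnorm, NNReal.coe_one]
  exact (norm_p_pos_lt (p := p) (K := K)).2

omit [NontriviallyNormedField K] [NormedAlgebra ℚ_[p] K] [IsUltrametricDist K] [CompleteSpace K] hE hint in
/-- `n + 1 ≤ p^n` for a prime `p` (indeed for any `p ≥ 2`). [folklore] -/
theorem natCast_succ_le_prime_pow (n : ℕ) : (n : ℝ) + 1 ≤ (p : ℝ) ^ n := by
  have h2 : n + 1 ≤ 2 ^ n := Nat.lt_two_pow_self
  have hp2 : 2 ^ n ≤ p ^ n := Nat.pow_le_pow_left hp.out.two_le n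
  exact_mod_cast h2.trans hp2

omit hE in
/-- **Quadratic estimate for the series logarithm on the level**: for `Q ∈ E⁽ᵖ⁾(K)`
(`Q ∈ E₁(K)`, `‖z(Q)‖ ≤ ‖p‖`), `‖Λ(Q) − z(Q)‖ ≤ ‖z(Q)‖² / ‖p‖` — tangency of `log(t) = t + Σ_{n≥2} logₙ tⁿ`
with `‖logₙ‖ ≤ n` and `n ‖p‖^{n−2} ≤ ‖p‖⁻¹` (`n ≤ p^{n−1}`). [cite: SilvermanAEC2009, Lemma IV.6.3 with Prop. VII.2.2] -/
theorem norm_ptLog_sub_zCoord_le {Q : (curveK p K M).toAffine.Point}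
    (hQ : Q ∈ level (NormedField.valuation (K := K)) (curveK p K M)
      (NormedField.valuation ((p : ℕ) : K))) :
    ‖ptLog p K M Q - Q.zCoord‖ ≤ ‖Q.zCoord‖ ^ 2 / ‖((p : ℕ) : K)‖ := by
  obtain ⟨hp0, hp1⟩ := norm_p_pos_lt (p := p) (K := K)
  have hz : ‖Q.zCoord‖ ≤ ‖((p : ℕ) : K)‖ := by
    have h := hQ.2
    rw [NormedField.valuation_apply, NormedField.valuation_apply, ← NNReal.coe_le_coe, coe_nnnorm,
      coe_nnnorm] at h
    exact h
  have hzlt : ‖Q.zCoord‖ < 1 := hz.trans_lt hp1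
  rw [div_eq_mul_inv]
  refine norm_bLog_sub_le (p := p) (K := K) (M := M) hzlt hz (inv_nonneg.mpr (norm_nonneg _))
    fun n hn => ?_
  -- `n ‖p‖^{n-2} ≤ ‖p‖⁻¹`, i.e. `n ≤ p^{n-1}`; write `n = 2 + k`
  obtain ⟨k, rfl⟩ := Nat.exists_eq_add_of_le hn
  rw [Nat.add_sub_cancel_left, norm_natCast_prime, inv_inv, inv_pow, ← div_eq_mul_inv,
    div_le_iff₀ (pow_pos (by exact_mod_cast hp.out.pos) _), ← pow_succ']
  have h := natCast_succ_le_prime_pow (p := p) (k + 1)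
  push_cast at h ⊢
  linarith

/-! ## §2 The series logarithm has (SPEC); `Λ = limitLog` on the level -/

/-- **`Λ = BallEval.ptLog` has the approximation property (SPEC) on the level `E⁽ᵖ⁾`**:
`‖Λ(Q) − z(pʳ•Q)/pʳ‖ ≤ ‖p‖^{r+1}` — it is additive on `E₁(K) ⊇ E⁽ᵖ⁾` (`ptLog_add`) and has the quadratic
estimate (`norm_ptLog_sub_zCoord_le`), which is the characterisation
`spec_of_additive_of_val_sub_zCoord_le`. [cite: SilvermanAEC2009, Thm. IV.6.4 with Prop. VII.2.2] -/
theorem ptLog_spec :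
    ∀ Q ∈ level (NormedField.valuation (K := K)) (curveK p K M) (NormedField.valuation ((p : ℕ) : K)),
      ∀ r : ℕ, NormedField.valuation (ptLog p K M Q - ((p ^ r) • Q).zCoord / ((p : ℕ) : K) ^ r) ≤
        NormedField.valuation ((p : ℕ) : K) ^ (r + 1) := by
  refine spec_of_additive_of_val_sub_zCoord_le (norm_pos_iff.mp (norm_p_pos_lt (p := p) (K := K)).1)
    (fun P Q hP hQ => ptLog_add hP.1 hQ.1) fun Q hQ => ?_
  have h := norm_ptLog_sub_zCoord_le hQ
  rw [NormedField.valuation_apply, NormedField.valuation_apply, NormedField.valuation_apply,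
    ← NNReal.coe_le_coe, coe_nnnorm, NNReal.coe_div, NNReal.coe_pow, coe_nnnorm, coe_nnnorm]
  exact h

/-- **`Λ = limitLog` on the level `E⁽ᵖ⁾(K)`**: the series logarithm `log_E(z(Q))` of the x1b local series
IS the Literature limit logarithm `lim z(pʳ•Q)/pʳ` (uniqueness of (SPEC) functions, `eq_limitLog_of_spec`).
[cite: SilvermanAEC2009, Thm. IV.6.4 with Prop. VII.2.2] -/
theorem ptLog_eq_limitLog {Q : (curveK p K M).toAffine.Point}
    (hQ : Q ∈ level (NormedField.valuation (K := K)) (curveK p K M)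
      (NormedField.valuation ((p : ℕ) : K))) :
    ptLog p K M Q = limitLog (NormedField.valuation (K := K)) (curveK p K M) p Q :=
  eq_limitLog_of_spec valuation_natCast_prime_lt_one ptLog_spec hQ

omit hE [CompleteSpace K] in
/-- Over an UNRAMIFIED `K` (`‖x‖ < 1 ⇒ ‖x‖ ≤ ‖p‖`) the level `E⁽ᵖ⁾(K)` is all of `E₁(K)`.
[cite: SilvermanAEC2009, Prop. VII.2.2] -/
theorem level_eq_kernel_of_unramified (hK : ∀ x : K, ‖x‖ < 1 → ‖x‖ ≤ ‖((p : ℕ) : K)‖) :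
    level (NormedField.valuation (K := K)) (curveK p K M) (NormedField.valuation ((p : ℕ) : K)) =
      kernel (NormedField.valuation (K := K)) (curveK p K M) := by
  refine level_val_natCast_eq_kernel fun x hx => ?_
  rw [NormedField.valuation_apply, NormedField.valuation_apply, ← NNReal.coe_le_coe, coe_nnnorm, coe_nnnorm]
  rw [NormedField.valuation_apply, ← NNReal.coe_lt_coe, coe_nnnorm, NNReal.coe_one] at hx
  exact hK x hx

/-- **`Λ = limitLog` on all of `E₁(K)` over an UNRAMIFIED `K`.** [cite: SilvermanAEC2009, Thm. IV.6.4 with Prop. VII.2.2] -/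
theorem ptLog_eq_limitLog_of_unramified (hK : ∀ x : K, ‖x‖ < 1 → ‖x‖ ≤ ‖((p : ℕ) : K)‖)
    {Q : (curveK p K M).toAffine.Point}
    (hQ : Q ∈ kernel (NormedField.valuation (K := K)) (curveK p K M)) :
    ptLog p K M Q = limitLog (NormedField.valuation (K := K)) (curveK p K M) p Q :=
  ptLog_eq_limitLog (by rw [level_eq_kernel_of_unramified hK]; exact hQ)

/-! ## §3 `Λ̃ = padicLogPointFiniteExt` on every point -/

omit hE [CompleteSpace K] in
/-- A point of `Ẽ₁(K)` (some `n • P ∈ E₁(K)`, `n ≥ 1`) has a positive multiple in the level `E⁽ᵖ⁾(K)`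
(`pʳ • n • P`, `exists_pow_smul_mem_level_of_mem_kernel`). [cite: SilvermanAEC2009, Prop. IV.3.2 with Prop. VII.2.2] -/
theorem exists_nsmul_mem_level_of_mem_satKernel {P : (curveK p K M).toAffine.Point}
    (hP : P ∈ satKernel p K M) :
    ∃ m : ℕ, 0 < m ∧ m • P ∈ level (NormedField.valuation (K := K)) (curveK p K M)
      (NormedField.valuation ((p : ℕ) : K)) := by
  obtain ⟨n, hn, hnP⟩ := hP
  obtain ⟨r, hr⟩ := exists_pow_smul_mem_level_of_mem_kernel (p := p)
    (norm_pos_iff.mp (norm_p_pos_lt (p := p) (K := K)).1) hnP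
  refine ⟨p ^ r * n, Nat.mul_pos (pow_pos hp.out.pos r) hn, ?_⟩
  rwa [mul_nsmul']

omit hE [CompleteSpace K] in
/-- Conversely a positive multiple in the level puts the point in `Ẽ₁(K)` (`E⁽ᵖ⁾ ⊆ E₁`). [folklore] -/
theorem mem_satKernel_of_nsmul_mem_level {P : (curveK p K M).toAffine.Point} {m : ℕ} (hm : 0 < m)
    (hmP : m • P ∈ level (NormedField.valuation (K := K)) (curveK p K M)
      (NormedField.valuation ((p : ℕ) : K))) :
    P ∈ satKernel p K M :=
  mem_satKernel_of_nsmul_mem hm hmP.1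

/-- **`Λ̃ P = limitLog(m • P)/m` for ANY `m ≥ 1` with `m • P ∈ E⁽ᵖ⁾(K)`.**
[cite: SilvermanAEC2009, Thm. IV.6.4 with Prop. VII.2.2] [cite: MazurTateTeitelbaum1986, §II] -/
theorem satLog_eq_limitLog_nsmul_div {P : (curveK p K M).toAffine.Point} {m : ℕ} (hm : 0 < m)
    (hmP : m • P ∈ level (NormedField.valuation (K := K)) (curveK p K M)
      (NormedField.valuation ((p : ℕ) : K))) :
    satLog p K M P = limitLog (NormedField.valuation (K := K)) (curveK p K M) p (m • P) / (m : K) := by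
  rw [satLog_eq_div hm hmP.1, ptLog_eq_limitLog hmP]

/-- **The log-currency junction: `Λ̃ = padicLogPointFiniteExt ‖·‖ E p` on EVERY point of `E(K)`** —
kport's saturated series logarithm (`KPort.satLog`, the `Λ̃` of `clause_d_unit_package`'s log-lattice
`Λ₀ʷ`) is the Literature logarithm `log_ω(P) = limitLog(m₀•P)/m₀` of `PadicLogFiniteExtension` (the
currency of the cite facts (S5b)/(S5b-res)). On `Ẽ₁(K)` both equal `limitLog(m•P)/m` for a common
admissible `m`; off `Ẽ₁(K)` both are the junk value `0`.
[cite: SilvermanAEC2009, Thm. IV.6.4 with Prop. VII.2.2] [cite: MazurTateTeitelbaum1986, §II] -/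
theorem satLog_eq_padicLogPointFiniteExt (P : (curveK p K M).toAffine.Point) :
    satLog p K M P = padicLogPointFiniteExt (NormedField.valuation (K := K)) (curveK p K M) p P := by
  by_cases h : P ∈ satKernel p K M
  · obtain ⟨m, hm, hmP⟩ := exists_nsmul_mem_level_of_mem_satKernel h
    rw [satLog_eq_limitLog_nsmul_div hm hmP,
      padicLogPointFiniteExt_eq_div_of_completeSpace (norm_pos_iff.mp (norm_p_pos_lt (p := p) (K := K)).1)
        valuation_natCast_prime_lt_one hm hmP]
  · rw [satLog_of_not_mem h, padicLogPointFiniteExt_of_not_exists]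
    rintro ⟨m, hm, hmP⟩
    exact h (mem_satKernel_of_nsmul_mem_level hm hmP)

/-- The junction as an equality of functions `E(K) → K`. [cite: SilvermanAEC2009, Thm. IV.6.4 with Prop. VII.2.2] -/
theorem satLog_eq_padicLogPointFiniteExt' :
    satLog p K M = padicLogPointFiniteExt (NormedField.valuation (K := K)) (curveK p K M) p :=
  funext satLog_eq_padicLogPointFiniteExt

/-- The homomorphism `Λ̃ : Ẽ₁(K) →+ K` (`satLogHom`) evaluates to the Literature logarithm. [folklore] -/
theorem satLogHom_eq (P : satKernel p K M) :
    satLogHom p K M P = padicLogPointFiniteExt (NormedField.valuation (K := K)) (curveK p K M) p P :=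
  satLog_eq_padicLogPointFiniteExt (P : (curveK p K M).toAffine.Point)

/-- On `E₁(K)` itself: `Λ(Q) = log_E(z(Q)) = padicLogPointFiniteExt Q`. [cite: SilvermanAEC2009, Thm. IV.6.4 with Prop. VII.2.2] -/
theorem ptLog_eq_padicLogPointFiniteExt {Q : (curveK p K M).toAffine.Point}
    (hQ : Q ∈ kernel (NormedField.valuation (K := K)) (curveK p K M)) :
    ptLog p K M Q = padicLogPointFiniteExt (NormedField.valuation (K := K)) (curveK p K M) p Q := by
  rw [← satLog_of_mem hQ, satLog_eq_padicLogPointFiniteExt]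

/-! ## §4 The K-port's E-side statements in the Literature currency -/

section AdditiveReduction

/-- **At additive reduction `log_ω(Q) = limitLog(p • Q)/p` on `E₀(K)`** (`Δ, c₄ ∈ pℤ_p` ⇒ `p • E₀ ⊆ E₁`;
over an unramified `K` this is w2-acc4's `val_limitLog_smul_div_le_one` currency `ℓ(p•P)/p`).
[cite: SilvermanAEC2009, Prop. VII.2.1 and Thm. IV.6.4] -/
theorem padicLogPointFiniteExt_eq_limitLog_prime_nsmul_div_of_mem_E₀
    (hK : ∀ x : K, ‖x‖ < 1 → ‖x‖ ≤ ‖((p : ℕ) : K)‖) (hΔ : ‖M.Δ‖ < 1) (hc₄ : ‖M.c₄‖ < 1)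
    {Q : (curveK p K M).toAffine.Point}
    (hQ : Q ∈ (M.map (coeffHom p K)).nonsingularReductionSubgroup
      (Valuation.integer.integers (NormedField.valuation (K := K)))) :
    padicLogPointFiniteExt (NormedField.valuation (K := K)) (curveK p K M) p Q =
      limitLog (NormedField.valuation (K := K)) (curveK p K M) p (p • Q) / (p : K) := by
  rw [← satLog_eq_padicLogPointFiniteExt, satLog_eq_ptLog_prime_nsmul_div hΔ hc₄ hQ,
    ptLog_eq_limitLog_of_unramified hK (prime_nsmul_mem_kernel_of_mem_nonsingularReductionSubgroup hΔ hc₄ hQ)]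

end AdditiveReduction

section Addv

variable (W : WeierstrassCurve ℚ) [W.IsElliptic] [W.IsGloballyMinimal]

omit hE hint in
/-- **`‖log_ω Q‖ ≤ 1` for every `Q ∈ E₀(K)`** in the Literature currency — `W/ℚ` globally minimal, `p`
additive (`Addv W p`), `K ⊇ ℚ_p` complete ultrametric and UNRAMIFIED: clause 2 of kim3's CONSUMER THEOREM
(`…KPortReduction.norm_satLog_le_one_of_mem_nonsingularReductionSubgroup_of_addv` moved along the junction).
[cite: SilvermanAEC2009, IV.6.4 and Prop. VII.2.1–2.2] -/
theorem norm_padicLogPointFiniteExt_le_one_of_mem_E₀_of_addv (hadd : Addv W p)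
    (hK : ∀ x : K, ‖x‖ < 1 → ‖x‖ ≤ ‖((p : ℕ) : K)‖)
    [((integralModelInt W).map (Int.castRingHom ℤ_[p]) |>.map PadicInt.Coe.ringHom).IsElliptic]
    [(curveK p K ((integralModelInt W).map (Int.castRingHom ℤ_[p]))).IsIntegral
      (NormedField.valuation (K := K)).integer]
    {Q : (curveK p K ((integralModelInt W).map (Int.castRingHom ℤ_[p]))).toAffine.Point}
    (hQ : Q ∈ (((integralModelInt W).map (Int.castRingHom ℤ_[p])).map (coeffHom p K)).nonsingularReductionSubgroup
      (Valuation.integer.integers (NormedField.valuation (K := K)))) :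
    ‖padicLogPointFiniteExt (NormedField.valuation (K := K))
        (curveK p K ((integralModelInt W).map (Int.castRingHom ℤ_[p]))) p Q‖ ≤ 1 := by
  rw [← satLog_eq_padicLogPointFiniteExt]
  exact norm_satLog_le_one_of_mem_nonsingularReductionSubgroup_of_addv W hadd hK hQ

end Addv

section Equivariance

/-- **Galois equivariance in the K-port currency**: `log_ω(σ • P) = σ (log_ω P)` for every
`σ : K ≃ₐ[ℚ_[p]] K` and every point (`…KPortSatLogMap.satLog_galois` moved along the junction; the
Literature form `padicLogPointFiniteExt_map` asks for an isometric algebra automorphism — here isometry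
is automatic, `norm_algEquiv_eq`). [cite: SilvermanAEC2009, IV.6.4] -/
theorem padicLogPointFiniteExt_galois [Algebra.IsAlgebraic ℚ_[p] K] (σ : K ≃ₐ[ℚ_[p]] K)
    (P : (curveK p K M).toAffine.Point) :
    padicLogPointFiniteExt (NormedField.valuation (K := K)) (curveK p K M) p
        (Affine.Point.map (W' := (M.map PadicInt.Coe.ringHom).toAffine) (σ : K →ₐ[ℚ_[p]] K) P) =
      σ (padicLogPointFiniteExt (NormedField.valuation (K := K)) (curveK p K M) p P) := by
  rw [← satLog_eq_padicLogPointFiniteExt, ← satLog_eq_padicLogPointFiniteExt]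
  exact satLog_galois σ P

end Equivariance

section BaseChange

variable [(M.map PadicInt.Coe.ringHom).IsIntegral ℤ_[p]]
  [(M.map PadicInt.Coe.ringHom).IsIntegral (NormedField.valuation (K := ℚ_[p])).integer]

/-- **`log_ω(ι P₀) = ι (padicLog X P₀)` for every `ℚ_p`-point `P₀`** (`X = M ⊗ ℚ_p`, `ι : E(ℚ_p) → E(K)`):
the Literature logarithm over `K` restricts on `ℚ_p`-points to n1011's `ℤ_p`-linear logarithm `padicLog`
(`…KPortSatLogMap.satLog_map_ofId` moved along the junction). [cite: SilvermanAEC2009, IV.6.4 and VII.6.3] -/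
theorem padicLogPointFiniteExt_map_ofId (P₀ : (M.map PadicInt.Coe.ringHom).toAffine.Point) :
    padicLogPointFiniteExt (NormedField.valuation (K := K)) (curveK p K M) p
        (Affine.Point.map (W' := (M.map PadicInt.Coe.ringHom).toAffine) (Algebra.ofId ℚ_[p] K) P₀) =
      algebraMap ℚ_[p] K (padicLog (M.map PadicInt.Coe.ringHom) P₀) := by
  rw [← satLog_eq_padicLogPointFiniteExt]
  exact satLog_map_ofId P₀

end BaseChange

end Summit.BirchSwinnertonDyer.BirchSwinnertonDyer.Theorems.KPort

end
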